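import Summits.BirchSwinnertonDyer.BirchSwinnertonDyer.Theorems.ResidualThetaTransportAtTwoSignedMuVanishingAtTwoPlusAnalyticAtW
import Literature.NumberTheory.EllipticCurves.PAdicBSDSkinnerUrbanProofs
import Literature.NumberTheory.QuadraticForms.PadicSquareCriteria
import HarnessLib

/-!
# Route `ResidualThetaTransportAtTwo`, crux Kμ⁺ `SignedMuVanishingAtTwoPlus` (stmt-BirchSwinnertonDyer-20689):
# the analytic child `SignedMuAnalyticAtTwoPlus` (stmt-21437) read EXACTLY — `μ(L♭_f) = v₂(Ω_W/Ω⁺_f)` —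
# with NO Manin-constant input

Cell `bsd-wall`, width seat `bsd-wall-rtt-p4-w2` on the lead line `birth` (skeleton v3, stubs
`stub_signedResidualFiniteAtTwo` / `stub_periodUnitAtTwo` / `stub_flatMuZeroAtTwo`). THEOREMS ONLY (no `def`,
no named fact, no `sorry`); helper `--supports` the crux; nothing about any curve is asserted and BSD is not
proved by this. It complements the lead's helpers p566119 `…MuUnit` (the unit case), p567665 `…AnalyticAtW`
and p569783 `…AnalyticChild` (the child ⟺ FLAT granted Abbes–Ullmo), and the width seat rtt-p4-w3's p578368
`…FlatLayer` (FLAT ⟺ a `2`-adic unit coefficient in some even Mazur–Tate layer). ROUTE-INDEPENDENT (no `Theses`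
import: only `IsNewformOf`, `IsPollackPair`, `kobayashiL` and `Λ`-algebra appear); the thin companion
`…SignedMuVanishingAtTwoPlusNeronMuChild` restates the reading for the route decl `SignedMuAnalyticAtTwoPlus`,
adds the `Ω_W`-normalised layer certificate and the refuter door.

The analytic conjunct of Kμ⁺ (= child 21437) says, for the newform `f` of a habitat⁺ curve `W`, the period
ratio `ϖ ∈ ℚ` (`ϖ · Ω_W = Ω⁺_f`) and a Pollack pair `(L♯, L♭)` at `2` (`L⁺_W := kobayashiL 1 L♯ L♭ = L♭`):
«`μ(G) = m` for every `G ∈ Λ = ℤ₂⟦T⟧`, `m ≥ 0` with `ι G = 2^m ϖ · ι L♭`».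

* §1 (`Λ`-algebra, any prime `p`). **`μ(G) = m + v_p(ϖ) + μ(L)`** for every such `(G, m)`
  (`intCast_mu_eq_of_map_eq`; `v_p = padicValRat`; proof: `ϖ = p^{v} u` with `u ∈ ℤ_pˣ`
  (`padic_exists_eq_zpow_mul_unit`), descend
  `ι G = C(p^{m+v} u) ι L` or `ι (p^{-(m+v)} G) = C(u) ι L` to `Λ` and count `p`'s), hence
  `μ(G) = m ⟺ v_p(ϖ) + μ(L) = 0` (`mu_eq_iff_padicValRat_add_mu_eq_zero_of_map_eq`), and admissible
  `(G, m)` always exist (`exists_map_eq_C_pow_mul`, `m ≥ −v_p(ϖ)`). Generalises the unit case `|ϖ|_p = 1`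
  (`mu_eq_iff_not_C_dvd_of_map_eq`, p566119).
* §2 (EXACT READING, no Abbes–Ullmo). At `W`: the bookkeeping holds iff **`v₂(ϖ) + μ(L♭) = 0`**, i.e. iff
  **`μ(L♭_f) = v₂(Ω_W / Ω⁺_f)`** (`forall_mu_eq_iff_padicValRat_add_mu_eq_zero`,
  `forall_mu_eq_iff_mu_eq_padicValRat_periodIndex`): «the Néron-normalised flat `2`-adic `L`-function `ϖ L♭_f`
  is `2`-integral with `μ = 0`» (class-wide for the route decl: companion file `…NeronMuChild`). So the line's split
  (PER: `v₂(ϖ) = 0`) ∧ (FLAT: `μ(L♭) = 0`) is sufficient and loses exactly the classes where a `2` in the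
  period index `Ω_W/Ω⁺_f` would be matched by `μ(L♭_f) ≥ 1` — excluded by Abbes–Ullmo Thm. A on the habitat
  (`2 ∤ N_W`, `W[2]` irreducible).

References: R. Greenberg, V. Vatsal, Invent. Math. 142 (2000) p. 2 (2) and §3 Rem. 3.4 [GreenbergVatsal2000];
R. Pollack, Duke Math. J. 118 (2003) Prop. 6.18 [Pollack2003]; B. Mazur, J. Tate, J. Teitelbaum, Invent. Math.
84 (1986) §I.8 [MazurTateTeitelbaum1986Invent]; A. Abbes, E. Ullmo, Compositio Math. 103 (1996) Thm. A
[AbbesUllmo1996].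
-/

set_option autoImplicit false
set_option linter.dupNamespace false

noncomputable section

open scoped Classical MatrixGroups ModularForm

open CongruenceSubgroup WeierstrassCurve Literature.NumberTheory.EllipticCurves
  Literature.NumberTheory.EllipticCurves.ModularForms
  Summit.BirchSwinnertonDyer.Rank1Residual.Supersingular Summit.BirchSwinnertonDyer.Rank1Residual.X1

namespace Summit.BirchSwinnertonDyer.BirchSwinnertonDyer.Theorems.SignedMuAtTwo

/-! ## §1. `Λ`-algebra (any prime `p`): the exact `μ`-bookkeeping `μ(G) = m + v_p(ϖ) + μ(L)` -/

section Algebra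

variable {p : ℕ} [Fact p.Prime]

/-- `μ(C(p^k)) = k`. [folklore] -/
theorem mu_C_pow (k : ℕ) : MuLambda.mu (PowerSeries.C ((p : ℤ_[p]) ^ k) : IwasawaAlgebra p) = k :=
  (MuLambda.mu_eq_and_pfree_eq (g₀ := 1) (by simp [MuLambda.red]) (by rw [mul_one])).1

/-- `μ(C(u)·L) = μ(L)` for a unit `u ∈ ℤ_pˣ` and `L ≠ 0`. [folklore] -/
theorem mu_C_units_mul (u : ℤ_[p]ˣ) {L : IwasawaAlgebra p} (hL : L ≠ 0) :
    MuLambda.mu (PowerSeries.C (u : ℤ_[p]) * L) = MuLambda.mu L := by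
  have hCu : IsUnit (PowerSeries.C (u : ℤ_[p]) : IwasawaAlgebra p) := (Units.isUnit u).map PowerSeries.C
  rw [MuLambda.mu_mul hCu.ne_zero hL, ((MuLambda.isUnit_iff_mu_eq_zero_and_lam_eq_zero _).mp hCu).2.1,
    zero_add]

/-- `μ(C(p^k)·X) = k + μ(X)` for `X ≠ 0`. [folklore] -/
theorem mu_C_pow_mul (k : ℕ) {X : IwasawaAlgebra p} (hX : X ≠ 0) :
    MuLambda.mu (PowerSeries.C ((p : ℤ_[p]) ^ k) * X) = k + MuLambda.mu X := by
  rw [MuLambda.mu_mul (MuLambda.C_pow_ne_zero k) hX, mu_C_pow]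

/-- **The exact `μ`-bookkeeping.** For `ϖ ∈ ℚ`, `ϖ ≠ 0`, `L ∈ Λ`, `L ≠ 0`, and `G ∈ Λ` with
`ι G = C(p^m ϖ) · ι L` in `ℚ_p⟦T⟧`: `μ(G) = m + v_p(ϖ) + μ(L)` as integers (`v_p = padicValRat`).
Generalises the unit case `|ϖ|_p = 1` (`mu_eq_iff_not_C_dvd_of_map_eq`). [cite: GreenbergVatsal2000, p. 2, (2)] -/
theorem intCast_mu_eq_of_map_eq {G L : IwasawaAlgebra p} {ϖ : ℚ} {m : ℕ} (hϖ : ϖ ≠ 0) (hL0 : L ≠ 0)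
    (hG : iwasawaToPowerSeries p G =
      PowerSeries.C ((p : ℚ_[p]) ^ m * (ϖ : ℚ_[p])) * iwasawaToPowerSeries p L) :
    (MuLambda.mu G : ℤ) = m + padicValRat p ϖ + MuLambda.mu L := by
  have hp0 : (p : ℚ_[p]) ≠ 0 := by exact_mod_cast (Fact.out : p.Prime).ne_zero
  have hϖ' : ((ϖ : ℚ) : ℚ_[p]) ≠ 0 := by exact_mod_cast hϖ
  obtain ⟨u, hu⟩ := Literature.NumberTheory.QuadraticForms.padic_exists_eq_zpow_mul_unit hϖ'
  rw [Padic.valuation_ratCast] at hu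
  have hCuL : (PowerSeries.C (u : ℤ_[p]) * L : IwasawaAlgebra p) ≠ 0 :=
    mul_ne_zero (((Units.isUnit u).map PowerSeries.C).ne_zero) hL0
  rcases le_or_gt 0 ((m : ℤ) + padicValRat p ϖ) with hmv | hmv
  · -- `m + v ≥ 0`: `G = C(p^k) · C(u) · L` with `k = m + v`
    obtain ⟨k, hk⟩ : ∃ k : ℕ, (m : ℤ) + padicValRat p ϖ = k := ⟨_, (Int.toNat_of_nonneg hmv).symm⟩
    have hG' : iwasawaToPowerSeries p G =
        PowerSeries.C ((p : ℚ_[p]) ^ k * ((u : ℤ_[p]) : ℚ_[p])) * iwasawaToPowerSeries p L := by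
      rw [hG, hu, ← mul_assoc, ← zpow_natCast, ← zpow_add₀ hp0, hk, zpow_natCast]
    have hGeq := eq_C_pow_mul_of_map_eq u hG'
    rw [hGeq, mu_C_pow_mul k hCuL, mu_C_units_mul u hL0]
    push_cast
    omega
  · -- `m + v < 0`: `C(p^k) · G = C(u) · L` with `k = -(m + v)`
    obtain ⟨k, hk⟩ : ∃ k : ℕ, (m : ℤ) + padicValRat p ϖ = -k :=
      ⟨(-((m : ℤ) + padicValRat p ϖ)).toNat, by omega⟩
    have hscal : (p : ℚ_[p]) ^ k * ((p : ℚ_[p]) ^ m * (ϖ : ℚ_[p])) =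
        (p : ℚ_[p]) ^ 0 * ((u : ℤ_[p]) : ℚ_[p]) := by
      rw [pow_zero, one_mul, hu, ← mul_assoc, ← mul_assoc, ← zpow_natCast, ← zpow_natCast,
        ← zpow_add₀ hp0, ← zpow_add₀ hp0, show ((k : ℕ) : ℤ) + ((m : ℕ) : ℤ) + padicValRat p ϖ = 0 by omega,
        zpow_zero, one_mul]
    have hG' : iwasawaToPowerSeries p (PowerSeries.C ((p : ℤ_[p]) ^ k) * G) =
        PowerSeries.C ((p : ℚ_[p]) ^ 0 * ((u : ℤ_[p]) : ℚ_[p])) * iwasawaToPowerSeries p L := by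
      rw [map_mul, iwasawaToPowerSeries_C_natCast_pow, hG, ← mul_assoc, ← map_mul, hscal]
    have hGeq := eq_C_pow_mul_of_map_eq u hG'
    rw [pow_zero, map_one, one_mul] at hGeq
    have hG0 : G ≠ 0 := by
      rintro rfl
      rw [mul_zero] at hGeq
      exact hCuL hGeq.symm
    have hμ : k + MuLambda.mu G = MuLambda.mu L := by
      rw [← mu_C_pow_mul k hG0, hGeq, mu_C_units_mul u hL0]
    omega

/-- **`μ(G) = m ⟺ v_p(ϖ) + μ(L) = 0`**: the Kμ⁺ bookkeeping at `(G, m)` says exactly that the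
`ϖ`-normalised `L`, `ϖ·L ∈ ℚ_p⟦T⟧`, is `p`-integral with `μ = 0`. [cite: GreenbergVatsal2000, p. 2, (2)] -/
theorem mu_eq_iff_padicValRat_add_mu_eq_zero_of_map_eq {G L : IwasawaAlgebra p} {ϖ : ℚ} {m : ℕ}
    (hϖ : ϖ ≠ 0) (hL0 : L ≠ 0)
    (hG : iwasawaToPowerSeries p G =
      PowerSeries.C ((p : ℚ_[p]) ^ m * (ϖ : ℚ_[p])) * iwasawaToPowerSeries p L) :
    MuLambda.mu G = m ↔ padicValRat p ϖ + MuLambda.mu L = 0 := by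
  have h := intCast_mu_eq_of_map_eq hϖ hL0 hG
  omega

/-- **Non-vacuity**: for `ϖ ≠ 0` and any `L ∈ Λ` there ARE `G ∈ Λ`, `m ≥ 0` with `ι G = C(p^m ϖ) · ι L`
(take `m ≥ -v_p(ϖ)`). [folklore] -/
theorem exists_map_eq_C_pow_mul {ϖ : ℚ} (hϖ : ϖ ≠ 0) (L : IwasawaAlgebra p) :
    ∃ (G : IwasawaAlgebra p) (m : ℕ), iwasawaToPowerSeries p G =
      PowerSeries.C ((p : ℚ_[p]) ^ m * (ϖ : ℚ_[p])) * iwasawaToPowerSeries p L := by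
  have hp0 : (p : ℚ_[p]) ≠ 0 := by exact_mod_cast (Fact.out : p.Prime).ne_zero
  have hϖ' : ((ϖ : ℚ) : ℚ_[p]) ≠ 0 := by exact_mod_cast hϖ
  obtain ⟨u, hu⟩ := Literature.NumberTheory.QuadraticForms.padic_exists_eq_zpow_mul_unit hϖ'
  set v : ℤ := ((ϖ : ℚ) : ℚ_[p]).valuation with hv
  -- `m = (-v).toNat`, `k = m + v ≥ 0`
  obtain ⟨m, k, hk⟩ : ∃ m k : ℕ, (m : ℤ) + v = k :=
    ⟨(-v).toNat, ((-v).toNat + v).toNat, (Int.toNat_of_nonneg (by omega)).symm⟩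
  refine ⟨PowerSeries.C ((p : ℤ_[p]) ^ k) * (PowerSeries.C (u : ℤ_[p]) * L), m, ?_⟩
  have hscal : (p : ℚ_[p]) ^ k * ((u : ℤ_[p]) : ℚ_[p]) = (p : ℚ_[p]) ^ m * (ϖ : ℚ_[p]) := by
    rw [hu, ← mul_assoc, ← zpow_natCast, ← zpow_natCast, ← zpow_add₀ hp0, hk]
  -- `ι (C u) = C u`
  have hC : iwasawaToPowerSeries p (PowerSeries.C (u : ℤ_[p])) = PowerSeries.C (((u : ℤ_[p]) : ℤ_[p]) : ℚ_[p]) := by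
    simp [iwasawaToPowerSeries]
  rw [map_mul, map_mul, iwasawaToPowerSeries_C_natCast_pow, hC, ← mul_assoc, ← map_mul, hscal]

end Algebra

/-! ## §2. At a curve `W` (`p = 2`): the analytic child holds at `(W, f, ϖ, L♯, L♭)` iff
`v₂(ϖ) + μ(L♭) = 0` — NO Manin-constant input -/

section AtW

variable {W : WeierstrassCurve ℚ} [W.IsElliptic] [W.IsGloballyMinimal] {N : ℕ} [NeZero N]
  {f : CuspForm (Gamma0 N) 2}

omit [W.IsElliptic] [W.IsGloballyMinimal] in
/-- The period ratio `ϖ` (`ϖ · Ω_W = Ω⁺_f`) of a curve with newform `f` is non-zero (`Ω⁺_f > 0`,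
`IsNewform0.plusPeriod_pos`). [cite: MazurTateTeitelbaum1986Invent, §I.8] -/
theorem periodRatio_ne_zero (hf : IsNewformOf W f) {ϖ : ℚ} (hϖ : (ϖ : ℝ) * W.realPeriodRat = plusPeriod f) :
    ϖ ≠ 0 := by
  rintro rfl
  have hpos : 0 < plusPeriod f := IsNewform0.plusPeriod_pos_holds hf.1 hf.coeffField_eq_bot
  rw [Rat.cast_zero, zero_mul] at hϖ
  exact hpos.ne hϖ

omit [W.IsElliptic] [W.IsGloballyMinimal] in
/-- **EXACT READING of the analytic bookkeeping at `W` (no period-unit / Manin-constant input).** For the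
newform `f` of `W`, the period ratio `ϖ` (`ϖ Ω_W = Ω⁺_f`) and a Pollack pair `(L♯, L♭)` at `2`:
«`μ(G) = m` for every `G ∈ Λ`, `m ≥ 0` with `ι G = 2^m ϖ · ι L⁺_W`» (`L⁺_W = kobayashiL 1 L♯ L♭ = L♭`)
holds IF AND ONLY IF `v₂(ϖ) + μ(L♭) = 0`, i.e. the Néron-normalised flat `2`-adic `L`-function `ϖ · L♭`
is `2`-integral with `μ = 0`. (Admissible `(G, m)` always exist, `exists_map_eq_C_pow_mul`.)
[cite: GreenbergVatsal2000, p. 2, (2) and §3, Remark 3.4] [cite: Pollack2003, Prop. 6.18] -/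
theorem forall_mu_eq_iff_padicValRat_add_mu_eq_zero (hf : IsNewformOf W f) {ϖ : ℚ}
    (hϖ : (ϖ : ℝ) * W.realPeriodRat = plusPeriod f) {Lplus Lminus : IwasawaAlgebra 2}
    (hP : IsPollackPair f 2 Lplus Lminus) :
    (∀ (G : IwasawaAlgebra 2) (m : ℕ), iwasawaToPowerSeries 2 G =
        PowerSeries.C ((2 : ℚ_[2]) ^ m * (ϖ : ℚ_[2])) * iwasawaToPowerSeries 2 (kobayashiL 1 Lplus Lminus) →
        MuLambda.mu G = m) ↔
      padicValRat 2 ϖ + MuLambda.mu Lminus = 0 := by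
  have hk : kobayashiL (p := 2) 1 Lplus Lminus = Lminus := by unfold kobayashiL; rw [if_pos rfl]
  have h2 : ((2 : ℕ) : ℚ_[2]) = 2 := by norm_num
  have hϖ0 := periodRatio_ne_zero hf hϖ
  rw [hk]
  constructor
  · intro h
    obtain ⟨G, m, hG⟩ := exists_map_eq_C_pow_mul (p := 2) hϖ0 Lminus
    rw [h2] at hG
    exact (mu_eq_iff_padicValRat_add_mu_eq_zero_of_map_eq (p := 2) hϖ0 hP.2.1 (by rw [h2]; exact hG)).mp
      (h G m hG)
  · intro h G m hG
    exact (mu_eq_iff_padicValRat_add_mu_eq_zero_of_map_eq (p := 2) hϖ0 hP.2.1 (by rw [h2]; exact hG)).mpr h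

omit [W.IsGloballyMinimal] in
/-- The same reading against the PERIOD INDEX `u = Ω_W / Ω⁺_f ∈ ℚ` (`ϖ = u⁻¹`): the analytic bookkeeping
at `W` holds iff **`μ(L♭_f) = v₂(Ω_W / Ω⁺_f)`**. Under Abbes–Ullmo (`|u|₂ = 1` on the habitat) this is
`μ(L♭_f) = 0`; in general a `2` in the period index must be matched EXACTLY by `μ(L♭_f)`.
[cite: GreenbergVatsal2000, §3, Remark 3.4] [cite: Pollack2003, Prop. 6.18] -/
theorem forall_mu_eq_iff_mu_eq_padicValRat_periodIndex (hf : IsNewformOf W f) {ϖ u : ℚ}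
    (hϖ : (ϖ : ℝ) * W.realPeriodRat = plusPeriod f) (hΩ : W.realPeriodRat = u * plusPeriod f)
    {Lplus Lminus : IwasawaAlgebra 2} (hP : IsPollackPair f 2 Lplus Lminus) :
    (∀ (G : IwasawaAlgebra 2) (m : ℕ), iwasawaToPowerSeries 2 G =
        PowerSeries.C ((2 : ℚ_[2]) ^ m * (ϖ : ℚ_[2])) * iwasawaToPowerSeries 2 (kobayashiL 1 Lplus Lminus) →
        MuLambda.mu G = m) ↔
      (MuLambda.mu Lminus : ℤ) = padicValRat 2 u := by
  rw [forall_mu_eq_iff_padicValRat_add_mu_eq_zero hf hϖ hP]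
  -- `ϖ = u⁻¹`
  have hΩpos : 0 < W.realPeriodRat := W.realPeriodRat_pos_holds
  have hϖ0 := periodRatio_ne_zero hf hϖ
  have hu0 : u ≠ 0 := by rintro rfl; rw [Rat.cast_zero, zero_mul] at hΩ; exact hΩpos.ne' hΩ
  have hϖu : ϖ * u = 1 := by
    have h1 : ((ϖ : ℝ) * u - 1) * plusPeriod f = 0 := by
      rw [sub_mul, one_mul, mul_assoc, ← hΩ, hϖ, sub_self]
    have hf0 : plusPeriod f ≠ 0 := (IsNewform0.plusPeriod_pos_holds hf.1 hf.coeffField_eq_bot).ne'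
    exact_mod_cast sub_eq_zero.mp ((mul_eq_zero.mp h1).resolve_right hf0)
  have hϖeq : ϖ = u⁻¹ := eq_inv_of_mul_eq_one_left hϖu
  rw [hϖeq, padicValRat.inv]
  omega

end AtW

end Summit.BirchSwinnertonDyer.BirchSwinnertonDyer.Theorems.SignedMuAtTwo

end
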